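import Mathlib.RepresentationTheory.Homological.GroupCohomology.Shapiro
import Mathlib.RepresentationTheory.Homological.GroupCohomology.LongExactSequence
import Mathlib.RepresentationTheory.Homological.GroupCohomology.LowDegree
import Mathlib.RingTheory.Finiteness.Finsupp
import HarnessLib

/-!
# Cohomology of a group with a normal subgroup of infinite cyclic quotient (Wang sequence)

Topic `Algebra/Homology`; namespace `Literature.Algebra.Homology`.  Mathlib only.

Let `H ⊴ G` be a normal subgroup and `t ∈ G` such that `G / H` is infinite cyclic generated by
`t H` (every `g ∈ G` is `h tⁿ` with `h ∈ H`, `n ∈ ℤ`, and `tⁿ ∈ H` only for `n = 0`), and let `A`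
be a `k`-linear representation of `G`.  In Mathlib's model `Coind_H^G Res_H A` of the coinduced
representation (`Rep.coind H.subtype (Rep.res H.subtype A)`: functions `f : G → A` with
`f(h x) = h f(x)`, `G` acting by right translation) there is the SHORT EXACT SEQUENCE of
`G`-representations

`0 ⟶ A ⟶ Coind_H^G Res_H A ⟶ Coind_H^G Res_H A ⟶ 0`,

`a ↦ (x ↦ x a)`, `f ↦ (x ↦ t⁻¹ f(t x)) − f` (`toCoindRes`, `shiftHom`, `shortExact_shiftComplex`;
surjectivity by solving the difference equation along `ℤ ≅ ⟨t⟩`).  By Shapiro's lemma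
(`groupCohomology.coindIso`) its long exact cohomology sequence is the Wang-type sequence
`⋯ → Hⁿ(H, A) → Hⁿ⁺¹(G, A) → Hⁿ⁺¹(H, A) → ⋯`, whence:

* `isZero_groupCohomology_succ` — `Hⁿ(H, A) = 0 = Hⁿ⁺¹(H, A) ⟹ Hⁿ⁺¹(G, A) = 0`;
* `moduleFinite_groupCohomology_succ` — over a Noetherian `k`, if `Hⁿ(H, A)` and `Hⁿ⁺¹(H, A)` are
  finitely generated then so is `Hⁿ⁺¹(G, A)`;
* the INFINITE CYCLIC GROUP (`H = 1`): `isZero_groupCohomology_add_two_of_infinite_cyclic` —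
  **`Hⁿ⁺²(ℤ, A) = 0`**, and `moduleFinite_groupCohomology_of_infinite_cyclic` — every `Hⁿ(ℤ, A)`
  is finitely generated when `A` is;
* two layers (`G ⊵ H ⊵ 1` with both quotients infinite cyclic, e.g. `G ≅ ℤ²`):
  `isZero_groupCohomology_add_three_of_two_step` — **`Hⁿ⁺³(G, A) = 0`**, and
  `moduleFinite_groupCohomology_of_two_step`.

This is the resolution-free route (coinduction + long exact sequence, [Brown1982CohomologyGroups,
III (6.2) Shapiro, III §7 dimension shifting, VIII §2]) to the cohomological dimension `≤ rank`
of free abelian groups and the finiteness of their cohomology with finitely generated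
coefficients, used for the unipotent arithmetic groups `Γ_N ≅ ℤ²` of Bianchi groups.

## References

* K. S. Brown, *Cohomology of Groups*, GTM 87 (1982), III §6 (6.2), III §7, VIII §2
  [Brown1982CohomologyGroups].
-/

noncomputable section

open CategoryTheory CategoryTheory.Limits groupCohomology

universe u

namespace Literature.Algebra.Homology

variable {k G : Type u} [CommRing k] [Group G] (H : Subgroup G) (A : Rep.{u} k G)

/-! ### The coinduced representation `Coind_H^G Res_H A` and the constant embedding -/

/-- `Coind_H^G Res_H A` in Mathlib's model: functions `f : G → A` with `f (h x) = h • f x`,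
`(g f)(x) = f(x g)`. [folklore] -/
abbrev coindRes : Rep.{u} k G := Rep.coind H.subtype (Rep.res H.subtype A)

/-- Elements of `Coind_H^G Res_H A` satisfy `f(h x) = h f(x)`. [folklore] -/
theorem coindRes_apply_mul (f : coindRes H A) (h : H) (x : G) :
    (f : G → A) ((h : G) * x) = A.ρ (h : G) ((f : G → A) x) :=
  f.2 h x

/-- The action: `(g f)(x) = f(x g)`. [folklore] -/
theorem coindRes_ρ_apply (g : G) (f : coindRes H A) (x : G) :
    (((coindRes H A).ρ g f : coindRes H A) : G → A) x = (f : G → A) (x * g) :=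
  rfl

/-- The embedding `A → Coind_H^G Res_H A`, `a ↦ (x ↦ x a)`, as a linear map. [folklore] -/
def toCoindResLinear : A →ₗ[k] coindRes H A where
  toFun a := ⟨fun x => A.ρ x a, fun h x => by
    change A.ρ ((h : G) * x) a = A.ρ (h : G) (A.ρ x a)
    rw [map_mul, Module.End.mul_apply]⟩
  map_add' a b := Subtype.ext (funext fun x => by simp)
  map_smul' r a := Subtype.ext (funext fun x => by simp)

/-- Unfolding lemma. [folklore] -/
@[simp]
theorem toCoindResLinear_apply_coe (a : A) (x : G) :
    ((toCoindResLinear H A a : coindRes H A) : G → A) x = A.ρ x a := rfl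

/-- **`A ⟶ Coind_H^G Res_H A`**, `a ↦ (x ↦ x a)`, a morphism of `G`-representations
(the unit of `Res ⊣ Coind` composed with `A ≅` constants). [cite: Brown1982CohomologyGroups, III §6 (6.2)] -/
def toCoindRes : A ⟶ coindRes H A :=
  Rep.ofHom (LinearMap.intertwiningMap_of_isIntertwiningMap A.ρ (coindRes H A).ρ
    (toCoindResLinear H A) fun g a => Subtype.ext (funext fun x => by
      change A.ρ x (A.ρ g a) = A.ρ (x * g) a
      rw [map_mul, Module.End.mul_apply]))

/-- Unfolding lemma. [folklore] -/
@[simp]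
theorem toCoindRes_hom_apply_coe (a : A) (x : G) :
    (((toCoindRes H A).hom a : coindRes H A) : G → A) x = A.ρ x a := rfl

/-- `toCoindRes` is injective (evaluate at `1`). [folklore] -/
theorem toCoindRes_injective : Function.Injective (toCoindRes H A).hom := by
  intro a b hab
  have h1 := congrFun (congrArg Subtype.val hab) 1
  change A.ρ 1 a = A.ρ 1 b at h1
  rwa [map_one, Module.End.one_apply, Module.End.one_apply] at h1

/-! ### The shift `f ↦ (x ↦ t⁻¹ f(t x))` -/

variable [H.Normal] (t : G)

/-- The shift `(S f)(x) = t⁻¹ f(t x)` on `Coind_H^G Res_H A` (normality of `H` makes `S f`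
again `H`-equivariant), as a linear map. [folklore] -/
def shiftLinear : coindRes H A →ₗ[k] coindRes H A where
  toFun f := ⟨fun x => A.ρ t⁻¹ ((f : G → A) (t * x)), fun h x => by
    have hn : t * (h : G) * t⁻¹ ∈ H := Subgroup.Normal.conj_mem inferInstance (h : G) h.2 t
    change A.ρ t⁻¹ ((f : G → A) (t * ((h : G) * x))) = A.ρ (h : G) (A.ρ t⁻¹ ((f : G → A) (t * x)))
    have hx : t * ((h : G) * x) = (t * (h : G) * t⁻¹) * (t * x) := by group
    rw [hx, coindRes_apply_mul H A f ⟨_, hn⟩ (t * x), ← Module.End.mul_apply, ← map_mul,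
      ← Module.End.mul_apply, ← map_mul]
    congr 2
    group⟩
  map_add' f f' := Subtype.ext (funext fun x => by simp)
  map_smul' r f := Subtype.ext (funext fun x => by simp)

/-- Unfolding lemma. [folklore] -/
@[simp]
theorem shiftLinear_apply_coe (f : coindRes H A) (x : G) :
    ((shiftLinear H A t f : coindRes H A) : G → A) x = A.ρ t⁻¹ ((f : G → A) (t * x)) := rfl

/-- **The shift is `G`-equivariant** (left translation by `t` commutes with the right regular
action). [folklore] -/
def shiftHom : coindRes H A ⟶ coindRes H A :=
  Rep.ofHom (LinearMap.intertwiningMap_of_isIntertwiningMap (coindRes H A).ρ (coindRes H A).ρ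
    (shiftLinear H A t) fun g f => Subtype.ext (funext fun x => by
      change A.ρ t⁻¹ ((f : G → A) (t * x * g)) = A.ρ t⁻¹ ((f : G → A) (t * (x * g)))
      rw [mul_assoc]))

/-- Unfolding lemma. [folklore] -/
@[simp]
theorem shiftHom_hom_apply_coe (f : coindRes H A) (x : G) :
    (((shiftHom H A t).hom f : coindRes H A) : G → A) x = A.ρ t⁻¹ ((f : G → A) (t * x)) := rfl

/-- `S ∘ ι = ι`: constants are shift-invariant. [folklore] -/
theorem toCoindRes_comp_shiftHom : toCoindRes H A ≫ shiftHom H A t = toCoindRes H A := by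
  refine Rep.hom_ext (Representation.IntertwiningMap.ext (LinearMap.ext fun a =>
    Subtype.ext (funext fun x => ?_)))
  change A.ρ t⁻¹ (A.ρ (t * x) a) = A.ρ x a
  rw [← Module.End.mul_apply, ← map_mul, inv_mul_cancel_left]

/-- **The shift complex** `A ⟶ Coind ⟶ Coind`, second map `S − 𝟙`. [cite: Brown1982CohomologyGroups, VIII §2] -/
def shiftComplex : ShortComplex (Rep.{u} k G) :=
  ShortComplex.mk (toCoindRes H A) (shiftHom H A t - 𝟙 _) (by
    rw [Preadditive.comp_sub, toCoindRes_comp_shiftHom, Category.comp_id, sub_self])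

/-- The second map of the shift complex is `S − 𝟙`. [folklore] -/
theorem shiftComplex_g : (shiftComplex H A t).g = shiftHom H A t - 𝟙 (coindRes H A) := rfl

/-- Unfolding lemma for `S − 𝟙`. [folklore] -/
theorem shiftHom_sub_id_hom_apply_coe (f : coindRes H A) (x : G) :
    (((shiftHom H A t - 𝟙 (coindRes H A)).hom f : coindRes H A) : G → A) x =
      A.ρ t⁻¹ ((f : G → A) (t * x)) - (f : G → A) x := by
  rw [Rep.sub_hom, Representation.IntertwiningMap.coe_sub, Pi.sub_apply]
  rfl

/-! ### Exactness, for `G / H` infinite cyclic generated by `t` -/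

variable {H t}

/-- A shift-invariant element of `Coind_H^G Res_H A` satisfies `f(tⁿ x) = tⁿ f(x)` for all
`n ∈ ℤ`. [folklore] -/
theorem apply_zpow_mul_of_shift_eq {f : coindRes H A} (hf : (shiftHom H A t).hom f = f) (n : ℤ)
    (x : G) : (f : G → A) (t ^ n * x) = A.ρ (t ^ n) ((f : G → A) x) := by
  have h1 : ∀ y, (f : G → A) (t * y) = A.ρ t ((f : G → A) y) := fun y => by
    have := congrFun (congrArg Subtype.val hf) y
    rw [shiftHom_hom_apply_coe] at this
    rw [← this, ← Module.End.mul_apply, ← map_mul, mul_inv_cancel, map_one, Module.End.one_apply]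
  have h2 : ∀ y, (f : G → A) (t⁻¹ * y) = A.ρ t⁻¹ ((f : G → A) y) := fun y => by
    have := h1 (t⁻¹ * y)
    rw [mul_inv_cancel_left] at this
    rw [this, ← Module.End.mul_apply, ← map_mul, inv_mul_cancel, map_one, Module.End.one_apply]
  induction n using Int.induction_on generalizing x with
  | zero => simp
  | succ n ih =>
    rw [zpow_add_one, mul_assoc, ih, h1, ← Module.End.mul_apply, ← map_mul]
  | pred n ih =>
    rw [zpow_sub_one, mul_assoc, ih, h2, ← Module.End.mul_apply, ← map_mul]

/-- **Kernel of `S − 𝟙` = constants** when `G = H · ⟨t⟩`: a shift-invariant `f` is `x ↦ x f(1)`.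
[cite: Brown1982CohomologyGroups, VIII §2] -/
theorem eq_toCoindRes_of_shift_eq (hgen : ∀ g : G, ∃ (h : H) (n : ℤ), g = (h : G) * t ^ n)
    {f : coindRes H A} (hf : (shiftHom H A t).hom f = f) :
    f = (toCoindRes H A).hom ((f : G → A) 1) := by
  refine Subtype.ext (funext fun x => ?_)
  obtain ⟨h, n, rfl⟩ := hgen x
  rw [toCoindRes_hom_apply_coe, coindRes_apply_mul, map_mul, Module.End.mul_apply]
  congr 1
  have := apply_zpow_mul_of_shift_eq A hf n 1
  rwa [mul_one] at this

section Solve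

variable (t) (g : coindRes H A)

/-- Forward solution of the difference equation `φ(n+1) = t (φ(n) + g(tⁿ))`, `φ(0) = 0`, on `ℕ`.
[folklore] -/
def solveNat : ℕ → A
  | 0 => 0
  | n + 1 => A.ρ t (solveNat n + (g : G → A) (t ^ (n : ℤ)))

/-- Backward solution: `ψ(m+1) = t⁻¹ ψ(m) − g(t^{-(m+1)})`, `ψ(0) = 0` (`ψ(m) = φ(-m)`). [folklore] -/
def solveNeg : ℕ → A
  | 0 => 0
  | m + 1 => A.ρ t⁻¹ (solveNeg m) - (g : G → A) (t ^ (Int.negSucc m))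

/-- The solution of the difference equation on `ℤ`. [folklore] -/
def solveInt : ℤ → A
  | Int.ofNat n => solveNat A t g n
  | Int.negSucc m => solveNeg A t g (m + 1)

omit [H.Normal] in
/-- **The difference equation** `φ(n + 1) = t (φ(n) + g(tⁿ))` holds for all `n ∈ ℤ`. [folklore] -/
theorem solveInt_add_one (n : ℤ) :
    solveInt A t g (n + 1) = A.ρ t (solveInt A t g n + (g : G → A) (t ^ n)) := by
  rcases n with n | m
  · rfl
  · cases m with
    | zero =>
      have e : Int.negSucc 0 + 1 = 0 := rfl
      rw [e]
      change (0 : A) = A.ρ t ((A.ρ t⁻¹ 0 - (g : G → A) (t ^ Int.negSucc 0)) +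
        (g : G → A) (t ^ Int.negSucc 0))
      rw [map_zero, zero_sub, neg_add_cancel, map_zero]
    | succ m =>
      have e : Int.negSucc (m + 1) + 1 = Int.negSucc m := rfl
      rw [e]
      change solveNeg A t g (m + 1) =
        A.ρ t ((A.ρ t⁻¹ (solveNeg A t g (m + 1)) - (g : G → A) (t ^ Int.negSucc (m + 1))) +
          (g : G → A) (t ^ Int.negSucc (m + 1)))
      rw [sub_add_cancel, ← Module.End.mul_apply, ← map_mul, mul_inv_cancel, map_one,
        Module.End.one_apply]

omit [H.Normal] in
/-- Equivalent form: `t⁻¹ φ(n+1) − φ(n) = g(tⁿ)`. [folklore] -/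
theorem inv_solveInt_add_one_sub (n : ℤ) :
    A.ρ t⁻¹ (solveInt A t g (n + 1)) - solveInt A t g n = (g : G → A) (t ^ n) := by
  rw [solveInt_add_one, ← Module.End.mul_apply, ← map_mul, inv_mul_cancel, map_one,
    Module.End.one_apply, add_sub_cancel_left]

end Solve

omit [H.Normal] in
/-- **Uniqueness of the decomposition `g = h tⁿ`** when `tⁿ ∈ H` only for `n = 0`. [folklore] -/
theorem decomposition_unique (hfree : ∀ n : ℤ, t ^ n ∈ H → n = 0) {h h' : H} {n m : ℤ}
    (he : (h : G) * t ^ n = (h' : G) * t ^ m) : h = h' ∧ n = m := by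
  have h1 : t ^ (n - m) = (h : G)⁻¹ * (h' : G) := by
    rw [zpow_sub, eq_inv_mul_iff_mul_eq, ← mul_assoc, he, mul_assoc, mul_inv_cancel, mul_one]
  have hnm : n - m = 0 := hfree _ (by rw [h1]; exact H.mul_mem (H.inv_mem h.2) h'.2)
  have hnm' : n = m := by omega
  subst hnm'
  exact ⟨Subtype.ext (mul_right_cancel he), rfl⟩

/-- **`S − 𝟙` is surjective** when `G / H` is infinite cyclic generated by `t`: the difference
equation `t⁻¹ f(t x) − f(x) = g(x)` is solved along `ℤ ≅ ⟨t⟩` and extended `H`-equivariantly.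
[cite: Brown1982CohomologyGroups, VIII §2] -/
theorem shiftComplex_g_surjective (hgen : ∀ g : G, ∃ (h : H) (n : ℤ), g = (h : G) * t ^ n)
    (hfree : ∀ n : ℤ, t ^ n ∈ H → n = 0) :
    Function.Surjective (shiftHom H A t - 𝟙 (coindRes H A)).hom := by
  intro g
  classical
  -- the decomposition `x = h_x t^{n_x}`
  let dh : G → H := fun x => Classical.choose (hgen x)
  let dn : G → ℤ := fun x => Classical.choose (Classical.choose_spec (hgen x))
  have hd : ∀ x, x = (dh x : G) * t ^ dn x := fun x =>
    Classical.choose_spec (Classical.choose_spec (hgen x))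
  have huniq : ∀ (x : G) (h : H) (n : ℤ), x = (h : G) * t ^ n → dh x = h ∧ dn x = n :=
    fun x h n hx => decomposition_unique hfree ((hd x).symm.trans hx)
  -- the candidate preimage
  let F : G → A := fun x => A.ρ (dh x : G) (solveInt A t g (dn x))
  have hF : ∀ (h : H) (n : ℤ), F ((h : G) * t ^ n) = A.ρ (h : G) (solveInt A t g n) := by
    intro h n
    obtain ⟨h1, h2⟩ := huniq ((h : G) * t ^ n) h n rfl
    simp only [F, h1, h2]
  have hFmem : F ∈ Representation.coindV H.subtype (Rep.res H.subtype A).ρ := by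
    intro h x
    change F ((h : G) * x) = A.ρ (h : G) (F x)
    conv_lhs => rw [hd x, ← mul_assoc, ← Subgroup.coe_mul, hF]
    conv_rhs => rw [hd x, hF]
    rw [Subgroup.coe_mul, map_mul, Module.End.mul_apply]
  refine ⟨⟨F, hFmem⟩, Subtype.ext (funext fun x => ?_)⟩
  rw [shiftHom_sub_id_hom_apply_coe]
  change A.ρ t⁻¹ (F (t * x)) - F x = (g : G → A) x
  have hx := hd x
  set h := dh x
  set n := dn x
  have hn : t * (h : G) * t⁻¹ ∈ H := Subgroup.Normal.conj_mem inferInstance (h : G) h.2 t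
  have htx : t * x = ((⟨t * (h : G) * t⁻¹, hn⟩ : H) : G) * t ^ (n + 1) := by
    rw [hx, zpow_add_one]
    change t * ((h : G) * t ^ n) = t * (h : G) * t⁻¹ * (t ^ n * t)
    group
  rw [htx, hF, hx, hF, coindRes_apply_mul]
  change A.ρ t⁻¹ (A.ρ (t * (h : G) * t⁻¹) (solveInt A t g (n + 1))) - A.ρ (h : G) (solveInt A t g n) =
    A.ρ (h : G) ((g : G → A) (t ^ n))
  rw [← Module.End.mul_apply, ← map_mul, show t⁻¹ * (t * (h : G) * t⁻¹) = (h : G) * t⁻¹ by group,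
    map_mul, Module.End.mul_apply, ← map_sub, inv_solveInt_add_one_sub]

variable (H t)

/-- **The shift sequence is short exact** for `G / H` infinite cyclic generated by `t`:
`0 ⟶ A ⟶ Coind_H^G Res_H A ⟶ Coind_H^G Res_H A ⟶ 0`. [cite: Brown1982CohomologyGroups, VIII §2] -/
theorem shortExact_shiftComplex (hgen : ∀ g : G, ∃ (h : H) (n : ℤ), g = (h : G) * t ^ n)
    (hfree : ∀ n : ℤ, t ^ n ∈ H → n = 0) : (shiftComplex H A t).ShortExact where
  exact := (forget₂ (Rep.{u} k G) (ModuleCat.{u} k)).reflects_exact_of_faithful _ <|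
    (ShortComplex.moduleCat_exact_iff _).2 fun f hf => by
      change (coindRes H A : Type u) at f
      change (shiftHom H A t - 𝟙 (coindRes H A)).hom f = 0 at hf
      refine ⟨(f : G → A) 1, ?_⟩
      have hf' : (shiftHom H A t).hom f = f := by
        rw [Rep.sub_hom, Representation.IntertwiningMap.coe_sub, Pi.sub_apply, sub_eq_zero] at hf
        exact hf
      exact (eq_toCoindRes_of_shift_eq A hgen hf').symm
  mono_f := (Rep.mono_iff_injective _).2 (toCoindRes_injective H A)
  epi_g := (Rep.epi_iff_surjective _).2 (shiftComplex_g_surjective A hgen hfree)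

/-! ### Cohomological consequences -/

/-- The middle term of an exact `X₁ → X₂ → X₃` of modules over a Noetherian ring with finitely
generated outer terms is finitely generated. [folklore] -/
private theorem moduleFinite_X₂_of_exact' [IsNoetherianRing k] (T : ShortComplex (ModuleCat.{u} k))
    (hT : T.Exact) (h₁ : Module.Finite k T.X₁) (h₃ : Module.Finite k T.X₃) : Module.Finite k T.X₂ := by
  have hrange : LinearMap.range T.f.hom = LinearMap.ker T.g.hom := hT.moduleCat_range_eq_ker
  refine Module.Finite.of_fg_top (Submodule.fg_of_fg_map_of_fg_inf_ker T.g.hom ?_ ?_)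
  · rw [Submodule.map_top]
    exact IsNoetherian.noetherian _
  · rw [top_inf_eq, ← hrange, LinearMap.range_eq_map]
    exact (Module.Finite.fg_top (R := k) (M := T.X₁)).map T.f.hom

/-- A zero module is finitely generated. [folklore] -/
private theorem moduleFinite_of_isZero {X : ModuleCat.{u} k} (h : IsZero X) : Module.Finite k X := by
  have : Subsingleton X := ⟨fun a b => by
    have hab : (𝟙 X : X ⟶ X).hom a = (𝟙 X : X ⟶ X).hom b := by
      rw [h.eq_of_src (𝟙 X) 0]; rfl
    exact hab⟩
  infer_instance

/-- **`Hⁿ(H, A) = 0 = Hⁿ⁺¹(H, A) ⟹ Hⁿ⁺¹(G, A) = 0`** for `G / H` infinite cyclic (the piece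
`Hⁿ(H, A) → Hⁿ⁺¹(G, A) → Hⁿ⁺¹(H, A)` of the long exact sequence of the shift sequence, with
Shapiro's isomorphisms). [cite: Brown1982CohomologyGroups, III §6 (6.2) and VIII §2] -/
theorem isZero_groupCohomology_succ (hgen : ∀ g : G, ∃ (h : H) (n : ℤ), g = (h : G) * t ^ n)
    (hfree : ∀ n : ℤ, t ^ n ∈ H → n = 0) (n : ℕ)
    (h₁ : IsZero (groupCohomology (Rep.res H.subtype A) n))
    (h₂ : IsZero (groupCohomology (Rep.res H.subtype A) (n + 1))) :
    IsZero (groupCohomology A (n + 1)) := by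
  have hX := shortExact_shiftComplex H A t hgen hfree
  have e := groupCohomology.mapShortComplex₁_exact hX (i := n) (j := n + 1) rfl
  have hz₁ : IsZero (groupCohomology (coindRes H A) n) :=
    h₁.of_iso (groupCohomology.coindIso (Rep.res H.subtype A) n)
  have hz₃ : IsZero (groupCohomology (coindRes H A) (n + 1)) :=
    h₂.of_iso (groupCohomology.coindIso (Rep.res H.subtype A) (n + 1))
  exact e.isZero_X₂ (hz₁.eq_of_src _ _) (hz₃.eq_of_tgt _ _)

/-- **Finiteness propagates**: over a Noetherian `k`, if `Hⁿ(H, A)` and `Hⁿ⁺¹(H, A)` are finitely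
generated then so is `Hⁿ⁺¹(G, A)` (`G / H` infinite cyclic). [cite: Brown1982CohomologyGroups, VIII §2] -/
theorem moduleFinite_groupCohomology_succ [IsNoetherianRing k]
    (hgen : ∀ g : G, ∃ (h : H) (n : ℤ), g = (h : G) * t ^ n)
    (hfree : ∀ n : ℤ, t ^ n ∈ H → n = 0) (n : ℕ)
    (h₁ : Module.Finite k (groupCohomology (Rep.res H.subtype A) n))
    (h₂ : Module.Finite k (groupCohomology (Rep.res H.subtype A) (n + 1))) :
    Module.Finite k (groupCohomology A (n + 1)) := by
  have hX := shortExact_shiftComplex H A t hgen hfree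
  have e := groupCohomology.mapShortComplex₁_exact hX (i := n) (j := n + 1) rfl
  have f₁ : Module.Finite k (groupCohomology (coindRes H A) n) :=
    Module.Finite.equiv (groupCohomology.coindIso (Rep.res H.subtype A) n).toLinearEquiv.symm
  have f₃ : Module.Finite k (groupCohomology (coindRes H A) (n + 1)) :=
    Module.Finite.equiv (groupCohomology.coindIso (Rep.res H.subtype A) (n + 1)).toLinearEquiv.symm
  exact moduleFinite_X₂_of_exact' _ e f₁ f₃

omit [H.Normal] in
/-- `H⁰(G, A)` is finitely generated when `A` is (Noetherian `k`): it is the invariants.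
[folklore] -/
theorem moduleFinite_groupCohomology_zero [IsNoetherianRing k] [Module.Finite k A] :
    Module.Finite k (groupCohomology A 0) :=
  Module.Finite.equiv (groupCohomology.H0Iso A).toLinearEquiv.symm

/-! ### The infinite cyclic group -/

omit [H.Normal] in
variable {H A t} in
/-- For `G = ⟨t⟩` every element is `1 · tⁿ` with `1 ∈ ⊥`. [folklore] -/
theorem hgen_bot (hcyc : ∀ g : G, ∃ n : ℤ, g = t ^ n) :
    ∀ g : G, ∃ (h : (⊥ : Subgroup G)) (n : ℤ), g = (h : G) * t ^ n := fun g => by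
  obtain ⟨n, rfl⟩ := hcyc g
  exact ⟨1, n, by simp⟩

/-- **`Hⁿ⁺²(ℤ, A) = 0`**: the cohomology of an infinite cyclic group `G = ⟨t⟩` (`tⁿ = 1` only
for `n = 0`) vanishes in degrees `≥ 2`, for every representation `A`.
[cite: Brown1982CohomologyGroups, III §1 Example 1 and VIII §2] -/
theorem isZero_groupCohomology_add_two_of_infinite_cyclic (hcyc : ∀ g : G, ∃ n : ℤ, g = t ^ n)
    (hfree : ∀ n : ℤ, t ^ n = 1 → n = 0) (n : ℕ) : IsZero (groupCohomology A (n + 2)) :=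
  isZero_groupCohomology_succ ⊥ A t (hgen_bot hcyc) (fun n hn => hfree n (Subgroup.mem_bot.1 hn))
    (n + 1) (isZero_groupCohomology_succ_of_subsingleton _ n)
    (isZero_groupCohomology_succ_of_subsingleton _ (n + 1))

/-- **`Hⁿ(ℤ, A)` is finitely generated** for `A` finitely generated over a Noetherian `k`.
[cite: Brown1982CohomologyGroups, III §1 Example 1] -/
theorem moduleFinite_groupCohomology_of_infinite_cyclic [IsNoetherianRing k] [Module.Finite k A]
    (hcyc : ∀ g : G, ∃ n : ℤ, g = t ^ n) (hfree : ∀ n : ℤ, t ^ n = 1 → n = 0) (n : ℕ) :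
    Module.Finite k (groupCohomology A n) := by
  rcases n with _ | _ | n
  · exact moduleFinite_groupCohomology_zero A
  · refine moduleFinite_groupCohomology_succ ⊥ A t (hgen_bot hcyc)
      (fun n hn => hfree n (Subgroup.mem_bot.1 hn)) 0 ?_ ?_
    · haveI : Module.Finite k (Rep.res (⊥ : Subgroup G).subtype A) := ‹Module.Finite k A›
      exact moduleFinite_groupCohomology_zero _
    · exact moduleFinite_of_isZero (isZero_groupCohomology_succ_of_subsingleton _ 0)
  · exact moduleFinite_of_isZero (isZero_groupCohomology_add_two_of_infinite_cyclic A t hcyc hfree n)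

/-! ### Two layers: `G ⊵ H ⊵ 1` with infinite cyclic quotients (e.g. `G ≅ ℤ²`) -/

/-- **`Hⁿ⁺³(G, A) = 0`** when `G ⊵ H` has infinite cyclic quotient generated by `t` and `H` is
itself infinite cyclic generated by `s` — e.g. `G ≅ ℤ²`: the cohomological dimension of `ℤ²` is
at most `2`. [cite: Brown1982CohomologyGroups, VIII §2] -/
theorem isZero_groupCohomology_add_three_of_two_step
    (hgen : ∀ g : G, ∃ (h : H) (n : ℤ), g = (h : G) * t ^ n)
    (hfree : ∀ n : ℤ, t ^ n ∈ H → n = 0) (s : H) (hcyc : ∀ h : H, ∃ n : ℤ, h = s ^ n)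
    (hsfree : ∀ n : ℤ, s ^ n = 1 → n = 0) (n : ℕ) : IsZero (groupCohomology A (n + 3)) :=
  isZero_groupCohomology_succ H A t hgen hfree (n + 2)
    (isZero_groupCohomology_add_two_of_infinite_cyclic _ s hcyc hsfree n)
    (isZero_groupCohomology_add_two_of_infinite_cyclic _ s hcyc hsfree (n + 1))

/-- **`Hⁿ(G, A)` is finitely generated** for `A` finitely generated over a Noetherian `k`, when
`G ⊵ H ⊵ 1` has infinite cyclic quotients (e.g. `G ≅ ℤ²`). [cite: Brown1982CohomologyGroups, VIII §2] -/
theorem moduleFinite_groupCohomology_of_two_step [IsNoetherianRing k] [Module.Finite k A]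
    (hgen : ∀ g : G, ∃ (h : H) (n : ℤ), g = (h : G) * t ^ n)
    (hfree : ∀ n : ℤ, t ^ n ∈ H → n = 0) (s : H) (hcyc : ∀ h : H, ∃ n : ℤ, h = s ^ n)
    (hsfree : ∀ n : ℤ, s ^ n = 1 → n = 0) (n : ℕ) : Module.Finite k (groupCohomology A n) := by
  haveI : Module.Finite k (Rep.res H.subtype A) := ‹Module.Finite k A›
  rcases n with _ | n
  · exact moduleFinite_groupCohomology_zero A
  · exact moduleFinite_groupCohomology_succ H A t hgen hfree n
      (moduleFinite_groupCohomology_of_infinite_cyclic _ s hcyc hsfree n)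
      (moduleFinite_groupCohomology_of_infinite_cyclic _ s hcyc hsfree (n + 1))

end Literature.Algebra.Homology
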